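import Literature.AlgebraicGeometry.HodgeTheory.GAGALineBundlesOfSections
import Literature.AlgebraicGeometry.HodgeTheory.KodairaSerreSectionsAllDim
import HarnessLib

/-!
# GAGA for line bundles: the discharge

Proof file (leaf) for the named fact
`Literature.AlgebraicGeometry.HodgeTheory.serreGAGA_lineCocycle_iso_cartierDivisorCocycle`
(file `GAGALineBundles`; J.-P. Serre, *Géométrie algébrique et géométrie analytique* (1956), n° 20
Prop. 18 with `r = 1`, surjectivity: every holomorphic line cocycle on `X^an`, `X` smooth projective
over `ℂ`, is holomorphically isomorphic to `𝒪_X(D)^an` for a Cartier divisor `D`).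

The tree already proves the two halves of Serre's argument:

* `serreGAGA_lineCocycle_iso_cartierDivisorCocycle_of_kodairaSerre` (file `GAGALineBundlesOfSections`):
  GAGA for line bundles follows from the existence, for every holomorphic line bundle `L` on `X^an`, of
  an algebraic twist `L ⊗ 𝒪_X(D)^an` with a holomorphic section that does not vanish identically
  (divisor of a meromorphic section, Riemann extension in codimension `2`, Chow/GAGA for divisors);
* `kodairaSerre_exists_globalSection_algebraicTwist_holds` (file `KodairaSerreSectionsAllDim`): that
  existence statement, in all dimensions, by Serre's dimension count along a transverse flag of
  hyperplane sections (GAGA n° 16 Lemme 8).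

This file only composes them; it is kept a separate leaf so that neither of the two (heavy, mutually
independent) import cones has to absorb the other.

## References

* J.-P. Serre, *Géométrie algébrique et géométrie analytique*, Ann. Inst. Fourier 6 (1956), n° 16
  Lemme 8, n° 20 Prop. 18. [SerreGAGA1956]
* U. Görtz, T. Wedhorn, *Algebraic Geometry I*, 2nd ed. (2020), Prop. 11.21. [GortzWedhorn2020]
* C. Voisin, *Hodge Theory and Complex Algebraic Geometry I* (2002), Cor. 11.34. [VoisinHodgeI2002]
-/

namespace Literature.AlgebraicGeometry.HodgeTheory

/-- **GAGA for line bundles (Serre 1956, n° 20 Prop. 18, `r = 1`)**, discharged: for `X` smooth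
projective over `ℂ` with Hodge model `A`, every holomorphic rank-one cocycle on `A.carrier ≅ X^an` is
holomorphically isomorphic to `𝒪_X(D)^an` for some Cartier divisor `D` on `X` — Serre's proof:
a non-identically-vanishing section of an algebraic twist (`kodairaSerre_exists_globalSection_algebraicTwist_holds`,
n° 16 Lemme 8) and the divisor of that meromorphic section
(`serreGAGA_lineCocycle_iso_cartierDivisorCocycle_of_kodairaSerre`).
[cite: SerreGAGA1956, n° 20 Prop. 18 and n° 16 Lemme 8] [cite: GortzWedhorn2020, Prop. 11.21 (p. 374)] -/
theorem serreGAGA_lineCocycle_iso_cartierDivisorCocycle_holds :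
    serreGAGA_lineCocycle_iso_cartierDivisorCocycle :=
  serreGAGA_lineCocycle_iso_cartierDivisorCocycle_of_kodairaSerre
    kodairaSerre_exists_globalSection_algebraicTwist_holds

end Literature.AlgebraicGeometry.HodgeTheory
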